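import Summits.QuantumFields.BalabanUV.T4Continuum.Support.ShellMeasureAverageDerivativeChart
import Summits.QuantumFields.BalabanUV.T4Continuum.Support.ShellMeasureAverageAnalyticB7

/-!
# `T4Continuum.ShellMeasureAverageDerivativeB7` — row S48, file 3: THE PRINTED INSTANCE [B7] (15) — S48 (i)–(iii) with
# the analyticity hypothesis DISCHARGED by row S49 file 2 (`analyticOnNhd_Qtilde_gammaT`)
(cell `pub-balaban`, sub-cell `t4`, spine estimate NE7c (node U5b); NE7c ROUND-2 crew `t4-ne7c-formalise-*`, seat
`b2b-balaban-t4-ne7c-formalise-leaf-03` (gen 3); row S48 of `t4/b2b-balaban-t4-ne7c-p1/LEAVES-NE7c-P1.md` v2.2; ADDITIVE —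
imports this seat's `ShellMeasureAverageDerivativeChart` (p219080) and the owner's S49 file 2
`ShellMeasureAverageAnalyticB7` (p219014) ONLY; 0 def, 0 sorry, 0 cite)

HONEST FRAMING.  Finite four-torus programme, rung (B)+1 only — NOT infinite volume, NOT a mass gap, NOT the Clay
problem, NOT summit progress; (B), `BetaPertHyp`, (B^μ) are not consumed.  NE7c NOT PRINTED, NOT PROVED; «NE7c ⇐ the
named binders» (c3); NOTHING in the countdown moves.  CALCULUS on the PRINTED average [B7] (15) («Ū_c = exp[i Σ_{x∈B(c₋)}
L⁻ᵈ (1/i) log U(Γ_{c,x}) U(c)⁻¹] U(c)», [B12] p. 252 «the definition introduced in [12]») as typed in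
`B12AverageCorridor267` (corner cubes on `ℤᵈ`, DIVERGENCE D-b12g20.1 inherited); hypotheses = those of
`h_paragraph_p267_gammaT` (unit-bounded background `‖V b‖, ‖(V b)⁻¹‖ ≤ 1`, off-axis block loops `ε`-regular with
`0 ≤ ε ≤ 1/8`, Neumann budget `(Lᵈ/L)·24ε < 1`); nothing of Bałaban's ESTIMATES beyond these displayed hypotheses; no
`def … : Prop`.  HONEST DEPENDENCY (cell, verbatim): continuum YM on T⁴ ⇐ BetaPertH ∧ nine spine estimates (0/9
proved); BetaPertH ⇐ (D1) ∧ (D4) ∧ CAP+tail; G-an2-4 gates asym, D1 and NE2/3/4.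

CONTENT (per coarse bond `c`, chart `B : ↥(qppBonds L c) → 𝔸 ↦ Function.extend Subtype.val B 0` = `extQ L c B`):
* `analyticAt_Qtilde_gammaT_zero` — the owner's interim hypothesis `hQ` of `…Chart` §3 IS A THEOREM for [B7] (15)
  (`ShellMeasureAverageAnalyticB7.analyticOnNhd_Qtilde_gammaT` at the centre of its ball `1/(2816(d+1)L)`);
* **`fderiv_Qtilde_gammaT_zero_apply`** — (i) `DQ̃(0) v = LQ̃(extend v)(c)`: the `deriv`-typed «LQ̃» of
  `B12AverageCorridor267` IS the Fréchet derivative of the printed average in the chart, on EVERY direction;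
* **`LQ_gammaT_add`**, **`LQ_gammaT_smul`** — (ii) «LQ̃» of [B7] (15) is ADDITIVE and `ℂ`-HOMOGENEOUS at every coarse
  bond (typing (c) of `B12AverageCorridor267` — «additivity of LQ̃ NOT proved» — CLOSED for the printed instance under
  the small-field hypotheses above);
* **`fderiv_Qtilde_gammaT_zero_hopC`** — (iii) p. 267's `h` («LQ̃h = I») IS A RIGHT INVERSE OF THE FRÉCHET DERIVATIVE:
  `DQ̃(0) (hopC X) = X` with `hopC X = resQ (δ_{b₀(c)} (hGen c X))` — S46's `hLQh` for
  `Qt := fun B => Q̃_V(extend B)(c)`, `hop := hopC`; with `ShellMeasureAverageDerivativeChart.norm_hopC_chart_le` (S46's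
  `hHop`, bound `(Lᵈ/L)/(1 − (Lᵈ/L)·24ε)`) and `ShellMeasureAverageDerivative.hop_bound_nonneg` (S46's `hb`) BY NAME;
* `bcoefVal_eq_fderiv_gammaT` — the closed-form corridor coefficient `bcoefVal` of `B12AverageCorridor267` § 5 is
  `DQ̃(0)` on the corridor direction `δ_{⟨b₀(c),_⟩} X`.
WHAT THIS DOES NOT DO.  Reality ∕ ⋆-structure (S47, S50 f2, S51), the splitting (S50 f1), the assembly into S46's END
(S52), the region product (S53); NE7c NOT proved; 0/9 spine.
-/

noncomputable section

open Function Metric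

namespace Summit.QuantumFields.BalabanUV.T4Continuum.ShellMeasureAverageDerivativeB7

open Literature.MathematicalPhysics.QuantumFieldTheory.Balaban1983to89
open Literature.MathematicalPhysics.QuantumLattice (ZdEdge)
open B7BlockGeometry (qppBonds)
open B13CorridorSeparation (b0Z b0Z_mem_qppBonds)
open B12HOperator267 (bcoef gammaT)
open B12AverageCorridor267
open ShellMeasureAverageDerivative
open ShellMeasureAverageDerivativeChart
open ShellMeasureAverageAnalyticB7 (analyticOnNhd_Qtilde_gammaT)

variable {d : ℕ} {𝔸 : Type*} [NormedRing 𝔸] [NormedAlgebra ℂ 𝔸] [NormOneClass 𝔸] [CompleteSpace 𝔸]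
variable {L : ℕ}

/-- **THE OWNER'S INTERIM HYPOTHESIS IS A THEOREM FOR [B7] (15)**: the printed block average in the chart,
`B ↦ Q̃_V(extend B)(c)`, is analytic AT `0` — `analyticOnNhd_Qtilde_gammaT` (row S49 file 2) at the centre of its ball
`1/(2816(d+1)L)`. Hypotheses: `0 < L`, unit-bounded background, `ε`-regular off-axis loops at `c`, `0 ≤ ε ≤ 1/8`.
[folklore] -/
theorem analyticAt_Qtilde_gammaT_zero (hL : 0 < L) {V : ZdEdge d → 𝔸ˣ}
    (hV : ∀ b, ‖((V b : 𝔸ˣ) : 𝔸)‖ ≤ 1) (hV' : ∀ b, ‖(((V b)⁻¹ : 𝔸ˣ) : 𝔸)‖ ≤ 1) {ε : ℝ} (hε0 : 0 ≤ ε)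
    (hε : ε ≤ 1 / 8) (c : ZdEdge d)
    (hWc : ∀ x ∈ offAxis L c, ‖((loopW L (fun U : ZdEdge d → 𝔸ˣ => gammaT L U) V c x : 𝔸ˣ) : 𝔸) - 1‖ ≤ ε) :
    AnalyticAt ℂ (fun B : ↥(qppBonds L c) → 𝔸 =>
      Qtilde L (fun U : ZdEdge d → 𝔸ˣ => gammaT L U) V (Function.extend Subtype.val B (0 : ZdEdge d → 𝔸)) c) 0 := by
  have hLr : (0 : ℝ) < L := by exact_mod_cast hL
  exact analyticOnNhd_Qtilde_gammaT hL hV hV' hε0 hε hWc 0 (mem_ball_self (by positivity))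

/-- **(i) FOR [B7] (15): `DQ̃(0) v = LQ̃(extend v)(c)` ON EVERY DIRECTION** — the `deriv`-typed «LQ̃» of
`B12AverageCorridor267` IS the Fréchet derivative at `0` of the printed average in the chart. [folklore] -/
theorem fderiv_Qtilde_gammaT_zero_apply (hL : 0 < L) {V : ZdEdge d → 𝔸ˣ}
    (hV : ∀ b, ‖((V b : 𝔸ˣ) : 𝔸)‖ ≤ 1) (hV' : ∀ b, ‖(((V b)⁻¹ : 𝔸ˣ) : 𝔸)‖ ≤ 1) {ε : ℝ} (hε0 : 0 ≤ ε)
    (hε : ε ≤ 1 / 8) (c : ZdEdge d)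
    (hWc : ∀ x ∈ offAxis L c, ‖((loopW L (fun U : ZdEdge d → 𝔸ˣ => gammaT L U) V c x : 𝔸ˣ) : 𝔸) - 1‖ ≤ ε)
    (v : ↥(qppBonds L c) → 𝔸) :
    fderiv ℂ (fun B : ↥(qppBonds L c) → 𝔸 =>
        Qtilde L (fun U : ZdEdge d → 𝔸ˣ => gammaT L U) V (Function.extend Subtype.val B (0 : ZdEdge d → 𝔸)) c) 0 v =
      LQ L (fun U : ZdEdge d → 𝔸ˣ => gammaT L U) V (Function.extend Subtype.val v (0 : ZdEdge d → 𝔸)) c :=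
  fderiv_Qtilde_chart_zero_apply V c (analyticAt_Qtilde_gammaT_zero hL hV hV' hε0 hε c hWc) v

/-- **(ii) FOR [B7] (15): «LQ̃» IS ADDITIVE** at every coarse bond whose off-axis block loops are `ε`-regular —
typing (c) of `B12AverageCorridor267` («additivity of LQ̃ NOT proved») CLOSED for the printed instance. [folklore] -/
theorem LQ_gammaT_add (hL : 0 < L) {V : ZdEdge d → 𝔸ˣ}
    (hV : ∀ b, ‖((V b : 𝔸ˣ) : 𝔸)‖ ≤ 1) (hV' : ∀ b, ‖(((V b)⁻¹ : 𝔸ˣ) : 𝔸)‖ ≤ 1) {ε : ℝ} (hε0 : 0 ≤ ε)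
    (hε : ε ≤ 1 / 8) (c : ZdEdge d)
    (hWc : ∀ x ∈ offAxis L c, ‖((loopW L (fun U : ZdEdge d → 𝔸ˣ => gammaT L U) V c x : 𝔸ˣ) : 𝔸) - 1‖ ≤ ε)
    (B₁ B₂ : ZdEdge d → 𝔸) :
    LQ L (fun U : ZdEdge d → 𝔸ˣ => gammaT L U) V (B₁ + B₂) c =
      LQ L (fun U : ZdEdge d → 𝔸ˣ => gammaT L U) V B₁ c + LQ L (fun U : ZdEdge d → 𝔸ˣ => gammaT L U) V B₂ c :=
  LQ_add_of_analyticAt hL (isBlockLocal_gammaT hL) V c (analyticAt_Qtilde_gammaT_zero hL hV hV' hε0 hε c hWc) B₁ B₂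

/-- **(ii) FOR [B7] (15): «LQ̃» IS `ℂ`-HOMOGENEOUS** at every such coarse bond. [folklore] -/
theorem LQ_gammaT_smul (hL : 0 < L) {V : ZdEdge d → 𝔸ˣ}
    (hV : ∀ b, ‖((V b : 𝔸ˣ) : 𝔸)‖ ≤ 1) (hV' : ∀ b, ‖(((V b)⁻¹ : 𝔸ˣ) : 𝔸)‖ ≤ 1) {ε : ℝ} (hε0 : 0 ≤ ε)
    (hε : ε ≤ 1 / 8) (c : ZdEdge d)
    (hWc : ∀ x ∈ offAxis L c, ‖((loopW L (fun U : ZdEdge d → 𝔸ˣ => gammaT L U) V c x : 𝔸ˣ) : 𝔸) - 1‖ ≤ ε)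
    (a : ℂ) (B' : ZdEdge d → 𝔸) :
    LQ L (fun U : ZdEdge d → 𝔸ˣ => gammaT L U) V (a • B') c =
      a • LQ L (fun U : ZdEdge d → 𝔸ˣ => gammaT L U) V B' c :=
  LQ_smul_of_analyticAt hL (isBlockLocal_gammaT hL) V c (analyticAt_Qtilde_gammaT_zero hL hV hV' hε0 hε c hWc) a B'

/-- **(iii) FOR [B7] (15): p. 267's `h` IS A RIGHT INVERSE OF THE FRÉCHET DERIVATIVE** — `DQ̃(0) (hopC X) = X` at
every coarse bond `c`, with `hopC X = resQ (δ_{b₀(c)} (hGen c X))` (the corridor-supported `h` of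
`h_paragraph_p267_gammaT` seen in the chart; hypotheses exactly those of that theorem).  This is S46's binder `hLQh`
for `Qt := fun B => Q̃_V(extend B)(c)`, `hop := hopC …`; S46's `hHop`∕`hb` are
`ShellMeasureAverageDerivativeChart.norm_hopC_chart_le` ∕ `ShellMeasureAverageDerivative.hop_bound_nonneg`. [folklore] -/
theorem fderiv_Qtilde_gammaT_zero_hopC (hL : 0 < L) {V : ZdEdge d → 𝔸ˣ} {ε : ℝ} (hε0 : 0 ≤ ε) (hε : ε ≤ 1 / 8)
    (hW : ∀ c, ∀ x ∈ offAxis L c, ‖((loopW L (fun U : ZdEdge d → 𝔸ˣ => gammaT L U) V c x : 𝔸ˣ) : 𝔸) - 1‖ ≤ ε)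
    (hV : ∀ b, ‖((V b : 𝔸ˣ) : 𝔸)‖ ≤ 1) (hV' : ∀ b, ‖(((V b)⁻¹ : 𝔸ˣ) : 𝔸)‖ ≤ 1)
    (hbud : (L : ℝ) ^ d / L * (24 * ε) < 1) (c : ZdEdge d) (X : 𝔸) :
    fderiv ℂ (fun B : ↥(qppBonds L c) → 𝔸 =>
        Qtilde L (fun U : ZdEdge d → 𝔸ˣ => gammaT L U) V (Function.extend Subtype.val B (0 : ZdEdge d → 𝔸)) c) 0
      (hopC (resQ L c) (resQ_add L c) (resQ_smul L c) hL (isBlockLocal_gammaT hL) (isAxisStraightFamily_gammaT hL)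
        V hε0 hε hW hV hV' hbud c X) = X :=
  fderiv_Qtilde_chart_zero_hopC hL (isBlockLocal_gammaT hL) (isAxisStraightFamily_gammaT hL) V hε0 hε hW hV hV' hbud
    c (analyticAt_Qtilde_gammaT_zero hL hV hV' hε0 hε c (hW c)) X

/-- THE CLOSED-FORM CORRIDOR COEFFICIENT IS `DQ̃(0)` ON THE CORRIDOR DIRECTION, for [B7] (15):
`DQ̃(0) (δ_{⟨b₀(c),_⟩} X) = bcoefVal L γ V c X` (`B12AverageCorridor267` § 5's closed form; small field
`‖W_x(V) − 1‖ ≤ ε < 1` off-axis). [folklore] -/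
theorem bcoefVal_eq_fderiv_gammaT (hL : 0 < L) {V : ZdEdge d → 𝔸ˣ}
    (hV : ∀ b, ‖((V b : 𝔸ˣ) : 𝔸)‖ ≤ 1) (hV' : ∀ b, ‖(((V b)⁻¹ : 𝔸ˣ) : 𝔸)‖ ≤ 1) {ε : ℝ} (hε0 : 0 ≤ ε)
    (hε : ε ≤ 1 / 8) (c : ZdEdge d)
    (hWc : ∀ x ∈ offAxis L c, ‖((loopW L (fun U : ZdEdge d → 𝔸ˣ => gammaT L U) V c x : 𝔸ˣ) : 𝔸) - 1‖ ≤ ε)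
    (X : 𝔸) :
    fderiv ℂ (fun B : ↥(qppBonds L c) → 𝔸 =>
        Qtilde L (fun U : ZdEdge d → 𝔸ˣ => gammaT L U) V (Function.extend Subtype.val B (0 : ZdEdge d → 𝔸)) c) 0
      (Pi.single (⟨b0Z L c, b0Z_mem_qppBonds hL c⟩ : ↥(qppBonds L c)) X) =
      bcoefVal L (fun U : ZdEdge d → 𝔸ˣ => gammaT L U) V c X := by
  rw [← resQ_single hL c]
  exact apply_res_single_eq_bcoefVal (extQ L c) (resQ L c) (extQ_smul L c) hL (isBlockLocal_gammaT hL)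
    (isAxisStraightFamily_gammaT hL) V c (extQ_resQ L c) (Φ := fun B => Qtilde L _ V (extQ L c B) c)
    (fun _ => rfl) (analyticAt_Qtilde_gammaT_zero hL hV hV' hε0 hε c hWc).differentiableAt.hasFDerivAt
    (fun x hx => (hWc x hx).trans_lt (by linarith)) X

end Summit.QuantumFields.BalabanUV.T4Continuum.ShellMeasureAverageDerivativeB7

end
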